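import Literature.MathematicalPhysics.QuantumFieldTheory.Balaban1983to89.Node00.TorusCoverLocalGaugePrint
import Literature.MathematicalPhysics.QuantumFieldTheory.Balaban1983to89.Node00.TorusCoverBoxStencils

/-!
# NODE 00 — [6] PROPOSITION 6's GAUGE PUSHED DOWN TO THE IMAGE OF THE WHOLE DATUM BOX `□ = box L c.a c.M c.k` (not only a grid cube inside it): n07-e 36b's
# window-generic push-down `exists_localGauge10_window_of_gaugedBoundB8` at `X := box`, the three window facts being this seat's `TorusCoverBoxStencils` §4 — so that the
# per-plaquette ∕ per-bond local-gauge interface of [15] Sect. F's assembly (`…N07HalvingStepTopOfLocalLetters`) can be FED: every plaquette ∕ bond stencil lies in some `π(box)`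

Cell `pub-ymgap`, width seat `pub-ymgap-dag-n07-w4` (director-ym №197 ∕ HUMAN RULING D-0149), node N07 = [15] = [Balaban1985Variational]; [6] = [Balaban1985RegularSpaces];
INTENT-4 of 2026-08-28 (dag-n07-e g15's ANSWER to LOCATED-COVER-1: «the BOX-CONCLUSION edition you located is ONE application of `exists_localGauge10_window_of_gaugedBoundB8` at
`X := box L c.a c.M c.k` … please TAKE … key the box instance on 36b after it lands»).  NEW leaf, PROOF kind (no `def`); CONSUMED BY NAME, nothing modified: n07-e 36b
`Node00.TorusCoverLocalGaugePrint` (p589927: `exists_localGauge10_window_of_gaugedBoundB8`), this seat's `Node00.TorusCoverBoxStencils` (p590855: `Sect2.eq_of_cover_eq_of_mem_box`,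
`Sect2.add_e_mem_box_of_shift_mem_image`, `Sect2.sub_e_mem_box_of_unshift_mem_image`, `Sect2.mem_plaqInside_cover_box_propCube`, `Sect2.mem_bondsDeep_cover_box_propCube`),
n07-e FILE 26 `propCube`, 33b `Sect2.LocalGauge10On`.

WHY.  The grid cubes `cubeEnl S a 0` partition the torus, so the (152)∕(153) tokens' conclusions on them miss the face-straddling plaquettes and the near-face bond stencils
(this seat's LOCATED-COVER-1; `TorusCoverBoxStencils` header).  The [6]-Prop.-6 datum `c` of a cube carries its gauge on the whole box `□ = [Lᵏaᵢ, Lᵏ(aᵢ + M) − 1]ᵈ`; for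
the datum `propCube P n hn M a` of a grid cube that box exceeds the grid cube by `(11d + L)Lⁿ ≥ 13` sites upward, and `TorusCoverBoxStencils` §2 shows every plaquette
(resp. bond stencil) lies in the image of the box of the grid cube of its base corner (resp. base corner `− 𝟙`).  THIS FILE applies 36b at `X := box`: the only extra
hypothesis is the box's non-wrapping `Lᵏ·c.M < 2L^{m+K}` (width `<` period), under which the cover is injective on the box and unit steps seen on the torus lift into it.

CONTENTS.  ★★ `exists_localGauge10_box_of_gaugedBoundB8` (36b at `X := box P.L c.a c.M c.k`; ANY `CubeB8` datum), ★ `localGauge10On_box_of_gaugedBoundB8` (packed as 33b's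
clause `Sect2.LocalGauge10On (π box) η_n t U` for every `t > 2r`), `localGauge10On_coverBox_propCube_of_gaugedBoundB8` (the instance at the datum of a grid cube, non-wrapping
`Lⁿ(M + 11d + L) < 2L^{m+K}`) — with `TorusCoverBoxStencils` §2 the set `Y := π(box(propCube … a))`, `a = cubeIdx S (lift p.src)` resp. `cubeIdx S (lift b.src − 𝟙)`, serves the
per-plaquette ∕ per-bond tokens `LocalLetters167∕165TopStep(Core)` (`p ∈ plaqInside Y`, `b ∈ bondsDeep Y`).

HONEST FRAMING: one application of a landed theorem + packaging; [6] Proposition 6's conclusion at the datum (`GaugedBoundB8`) is a HYPOTHESIS here exactly as in 36b (its supplier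
is N05's member ∕ the (R-b) stub-2′ road); nothing of Bałaban asserted; N07 ∕ N05 NOT discharged; K0⁷ ∕ K1⁷ NOT closed; counts unmoved (28∕28 · 5∕27); one finite 𝕋⁴ programme at
fixed ε — R4 closes the conditional rung `BalabanLadder.UV` only: NOT continuum ∕ ℝ⁴ ∕ OS ∕ mass gap ∕ Clay.  Theorems only; no `def`, `instance`, `notation`, `sorry`.
-/

noncomputable section

namespace Literature.MathematicalPhysics.QuantumFieldTheory.Balaban1983to89.Node00

open scoped Matrix.Norms.L2Operator
open B7Prop1Explicit (e)
open B8Eq131Cubes (box bLo bHi)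
open B15Eq112TorusCover (cover lift)
open B14DomainGeom (Pt cubeIdx)
open B14.Eq213MaximalDomains (side)
open B12RegularSpaces111 (gaugeU expI grad)

variable {P : Params} {N : ℕ} [NeZero N]

/-- ★★ **[6] PROPOSITION 6's GAUGE ON THE IMAGE OF THE WHOLE DATUM BOX** (n07-e 36b's `exists_localGauge10_window_of_gaugedBoundB8` at `X := box P.L c.a c.M c.k`): for `d ≥ 2`,
ANY `CubeB8` datum `c` of scale `c.k = n` whose box does not wrap (`Lⁿ·c.M < 2L^{m+K}`), a torus configuration `U` whose lift carries `GaugedBoundB8 L η_n (zdLift N U) c r`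
(`0 ≤ r`) and the `2π`-window: `∃ u A` with `(ιU)^{ιu}(b) = expI η_n (A b)` and `‖A b‖ ≤ 2r` on the bonds of `Sect2.regionOfSet P (π box)`, `‖∇^{η_n}A‖ ≤ 2r` on its derivative
quadruples, `‖∂^{η_n*}∂^{η_n}A‖ ≤ 2r` on `Sect2.bondsDeep (π box)`.  The window facts are `TorusCoverBoxStencils` §4 (`hbox := subset_rfl`).
[cite: Balaban1985RegularSpaces, Prop. 6 (1.135)–(1.136) p.99, p.98; Balaban1985Variational, (144)–(152) pp.300–301; Balaban1987RG1, (0.1) p.251] -/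
theorem exists_localGauge10_box_of_gaugedBoundB8 (hd : 2 ≤ P.d) {K' : ℕ} {Ω' : ℕ → Set (B7Prop1Explicit.Site P.d)} (c : CubeB8 P.d P.L K' Ω')
    (U : GaugeField P 0 (SU N)) {n : ℕ} (hk : c.k = n) {r : ℝ} (hr : 0 ≤ r)
    (hG : letI : CStarAlgebra (MatA N) := {}; GaugedBoundB8 P.L (P.eta n) (zdLift N U) c r)
    (hW : ((P.L ^ c.k * c.M : ℕ) : ℤ) < P.sitesPerDir 0)
    (h2π : (2 * boxWidth (bLo P.L c.a c.k 0) (bHi P.L c.a c.M c.k 0) + 1) * (P.eta n * N * (r * ((P.L : ℝ) ^ c.k * P.eta n)⁻¹)) < 2 * Real.pi) :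
    ∃ u : GaugeTransf P 0 (SU N), ∃ A : PBond P 0 → MatA N,
      (∀ b ∈ (Sect2.regionOfSet P (cover P '' box P.L c.a c.M c.k)).bonds, gaugeU (fun x => ιSU N (u x)) (fun b' => ιSU N (U b')) b = expI (P.eta n) (A b)) ∧
      (∀ b ∈ (Sect2.regionOfSet P (cover P '' box P.L c.a c.M c.k)).bonds, ‖A b‖ ≤ 2 * r) ∧
      (∀ q ∈ (Sect2.regionOfSet P (cover P '' box P.L c.a c.M c.k)).dpairs, ‖grad (P.eta n) q.2.1 (fun y => A ⟨y, q.2.2⟩) q.1‖ ≤ 2 * r) ∧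
      ∀ b ∈ Sect2.bondsDeep (cover P '' box P.L c.a c.M c.k), ‖Sect2.codiffCurlA (P.eta n) A b.src b.dir‖ ≤ 2 * r :=
  exists_localGauge10_window_of_gaugedBoundB8 hd c U hk hr hG
    (fun _ hx _ hx' h => Sect2.eq_of_cover_eq_of_mem_box hW.le hx hx' h)
    (fun _ hx _ h => Sect2.add_e_mem_box_of_shift_mem_image hW hx h)
    (fun _ hx _ h => Sect2.sub_e_mem_box_of_unshift_mem_image hW hx h) subset_rfl h2π

/-- ★ **THE SAME, PACKED AS 33b's CLAUSE**: under the hypotheses of `exists_localGauge10_box_of_gaugedBoundB8`, `Sect2.LocalGauge10On (π box) η_n t U` for every `t > 2r` (33b's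
letters are strict). [cite: Balaban1985Variational, Thm 1 (9)–(10) p.279, (152) p.301; Balaban1985RegularSpaces, Prop. 6 (1.136) p.99] -/
theorem localGauge10On_box_of_gaugedBoundB8 (hd : 2 ≤ P.d) {K' : ℕ} {Ω' : ℕ → Set (B7Prop1Explicit.Site P.d)} (c : CubeB8 P.d P.L K' Ω')
    (U : GaugeField P 0 (SU N)) {n : ℕ} (hk : c.k = n) {r : ℝ} (hr : 0 ≤ r)
    (hG : letI : CStarAlgebra (MatA N) := {}; GaugedBoundB8 P.L (P.eta n) (zdLift N U) c r)
    (hW : ((P.L ^ c.k * c.M : ℕ) : ℤ) < P.sitesPerDir 0)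
    (h2π : (2 * boxWidth (bLo P.L c.a c.k 0) (bHi P.L c.a c.M c.k 0) + 1) * (P.eta n * N * (r * ((P.L : ℝ) ^ c.k * P.eta n)⁻¹)) < 2 * Real.pi)
    {t : ℝ} (ht : 2 * r < t) : Sect2.LocalGauge10On (cover P '' box P.L c.a c.M c.k) (P.eta n) t U := by
  obtain ⟨u, A, he, hA, hdA, h10⟩ := exists_localGauge10_box_of_gaugedBoundB8 hd c U hk hr hG hW h2π
  exact ⟨u, A, he, fun b hb => (hA b hb).trans_lt ht, fun q hq => (hdA q hq).trans_lt ht, fun b hb => (h10 b hb).trans_lt ht⟩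

/-- **THE INSTANCE AT THE DATUM OF A GRID CUBE** (`c := propCube P n hn M a`: corner `M·a` blocks, side `M + 11d + L`, scale `n`; non-wrapping `Lⁿ(M + 11d + L) < 2L^{m+K}`):
`Sect2.LocalGauge10On (π box(propCube …)) η_n t U` for every `t > 2r` — the set in which `TorusCoverBoxStencils` §2 places every plaquette (`a := cubeIdx S (lift p.src)`) and
every bond stencil (`a := cubeIdx S (lift b.src − 𝟙)`). [cite: Balaban1985Variational, (144) p.300, (152) p.301, p.302; Balaban1985RegularSpaces, Prop. 6 p.99, p.98] -/
theorem localGauge10On_coverBox_propCube_of_gaugedBoundB8 (hd : 2 ≤ P.d) {n : ℕ} (hn : 1 ≤ n) {M : ℕ} (a : Pt P.d) (U : GaugeField P 0 (SU N))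
    {r : ℝ} (hr : 0 ≤ r)
    (hG : letI : CStarAlgebra (MatA N) := {}; GaugedBoundB8 P.L (P.eta n) (zdLift N U) (propCube P n hn M a) r)
    (hW : ((P.L ^ n * (M + 11 * P.d + P.L) : ℕ) : ℤ) < P.sitesPerDir 0)
    (h2π : (2 * boxWidth (bLo P.L (propCube P n hn M a).a n 0) (bHi P.L (propCube P n hn M a).a (propCube P n hn M a).M n 0) + 1) *
        (P.eta n * N * (r * ((P.L : ℝ) ^ n * P.eta n)⁻¹)) < 2 * Real.pi)
    {t : ℝ} (ht : 2 * r < t) :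
    Sect2.LocalGauge10On (cover P '' box P.L (propCube P n hn M a).a (propCube P n hn M a).M n) (P.eta n) t U :=
  localGauge10On_box_of_gaugedBoundB8 hd (propCube P n hn M a) U (propCube_k P n hn M a) hr hG
    (by rw [propCube_k, propCube_M]; exact hW) (by rw [propCube_k]; exact h2π) ht

end Literature.MathematicalPhysics.QuantumFieldTheory.Balaban1983to89.Node00

end
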